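import Mathlib
import HarnessLib
import Literature.Analysis.FluidPDE.SelfSimilar
import Literature.Analysis.FluidPDE.LocalTypeI
import Literature.Analysis.FluidPDE.VectorCalculus
import Literature.Analysis.FluidPDE.IsometryInvariance
import Literature.Analysis.FluidPDE.CurlIsometryCovariance
import Literature.Analysis.UnboundedOperators.HeatKernel
import Summits.NavierStokesRegularity.NavierStokesRegularity.Theorems.RellichScarSimilarityCovarianceRotationTypeI
import Summits.NavierStokesRegularity.NavierStokesRegularity.Theorems.PoloidalWindowDoorPoloidalWindowRigidityRotate
import Summits.NavierStokesRegularity.NavierStokesRegularity.Theorems.PoloidalWindowDoorPoloidalWindowRigidityFlat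

/-!
# Route `PoloidalWindowDoor` (staged, nsreg-p1), crux `PoloidalWindowRigidity` — the flat stratum in ANY horizontal
# direction (frame-free form of the birth-skeleton stub `stub_flatStratum`)

Cell ns-regularity-ideate, seat p6 (route-directed support; land `--supports <PoloidalWindowRigidity item>` once the
route is born). After `stub_rotate` (WLOG `e = e₃`) the residual frame freedom of the K2 skeleton is the group of
rotations about `e₃`; the birth stub `stub_flatStratum` settles the flat stratum `∂₀(v·e₃) ≡ 0` in the FIXED direction
`e₀`, so the open stub `stub_nonflatLiouville` as registered still contains the settled mirror case `∂₁(v·e₃) ≡ 0`.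
`flatStratum_of_horizontal` removes the frame artefact: if `v·e₃` is independent of SOME horizontal direction
`a ≠ 0`, `⟪a, e₃⟫ = 0` (i.e. `⟪Dv(s)(y) a, e₃⟫ = 0` on every slice), the profile is not backward-singular — by
conjugating with the reflection of `ℝ³` that exchanges `e₀` and `a/‖a‖` and FIXES `e₃` (pseudovector law of the
curl, `CurlIsometryCovariance`; class transport `…Rotate.class_conj_linearIsometryEquiv`; the origin stays singular,
`RellichScarSimilarityCovariance.isBackwardSingularPoint_zero_conj`) and applying `stub_flatStratum`. Hence the honest
open residue of K2 is: poloidal along `e₃`, frozen constraint, and `v·e₃` NOT independent of ANY horizontal direction.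

WHAT THIS IS NOT: not a claim about Navier–Stokes regularity; a support lemma for a STAGED door route
(bears_on LADDER-NS N0, rung N0-LocalTubeDoorPoloidal).
-/

noncomputable section

-- the summit and its single sub-problem share the name (CONVENTIONS §1), as in every Theorems file
set_option linter.dupNamespace false

namespace Summit.NavierStokesRegularity.NavierStokesRegularity.Theorems.PoloidalWindowDoorPoloidalWindowRigidityFlatHorizontal

open MeasureTheory Set Function Filter Topology TopologicalSpace Metric
open scoped RealInnerProductSpace InnerProductSpace
open Literature.Analysis Literature.Analysis.FluidPDE
open Summit.NavierStokesRegularity.NavierStokesRegularity.Theorems.RellichScarSimilarityCovariance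
open Summit.NavierStokesRegularity.NavierStokesRegularity.Theorems.PoloidalWindowDoorPoloidalWindowRigidityRotate
open Summit.NavierStokesRegularity.NavierStokesRegularity.Theorems.PoloidalWindowDoorPoloidalWindowRigidityFlat

/-- A linear isometry of `ℝ³` taking the unit horizontal vector `a/‖a‖` (`a ≠ 0`, `⟪a, e₃⟫ = 0`) to `e₀` and fixing
`e₃`: the reflection in the hyperplane orthogonal to `e₀ − a/‖a‖` (both `e₃ ⟂ e₀` and `e₃ ⟂ a`). -/
theorem exists_linearIsometryEquiv_symm_single_zero_fix_single_two {a : EuclideanSpace ℝ (Fin 3)} (ha : a ≠ 0)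
    (ha3 : ⟪a, EuclideanSpace.single 2 1⟫_ℝ = 0) :
    ∃ L : EuclideanSpace ℝ (Fin 3) ≃ₗᵢ[ℝ] EuclideanSpace ℝ (Fin 3),
      L.symm (EuclideanSpace.single 0 1) = (‖a‖⁻¹ : ℝ) • a ∧
      L.symm (EuclideanSpace.single 2 1) = EuclideanSpace.single 2 1 := by
  set ahat : EuclideanSpace ℝ (Fin 3) := (‖a‖⁻¹ : ℝ) • a with hahat
  have hahat1 : ‖ahat‖ = 1 := norm_smul_inv_norm ha
  have he0 : ‖(EuclideanSpace.single (0 : Fin 3) (1 : ℝ) : EuclideanSpace ℝ (Fin 3))‖ = ‖ahat‖ := by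
    rw [EuclideanSpace.single, PiLp.norm_single, norm_one, hahat1]
  set R : EuclideanSpace ℝ (Fin 3) ≃ₗᵢ[ℝ] EuclideanSpace ℝ (Fin 3) :=
    Submodule.reflection (ℝ ∙ (EuclideanSpace.single (0 : Fin 3) (1 : ℝ) - ahat))ᗮ with hR
  have hRe : R (EuclideanSpace.single (0 : Fin 3) (1 : ℝ)) = ahat := Submodule.reflection_sub he0
  have hmem : (EuclideanSpace.single (2 : Fin 3) (1 : ℝ) : EuclideanSpace ℝ (Fin 3)) ∈
      (ℝ ∙ (EuclideanSpace.single (0 : Fin 3) (1 : ℝ) - ahat))ᗮ := by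
    rw [Submodule.mem_orthogonal_singleton_iff_inner_left, inner_sub_right, hahat, inner_smul_right,
      real_inner_comm a (EuclideanSpace.single 2 1), ha3, mul_zero, sub_zero]
    simp [EuclideanSpace.inner_single_left]
  have hR3 : R (EuclideanSpace.single (2 : Fin 3) (1 : ℝ)) = EuclideanSpace.single 2 1 :=
    Submodule.reflection_mem_subspace_eq_self hmem
  exact ⟨R.symm, by rw [LinearIsometryEquiv.symm_symm, hRe], by rw [LinearIsometryEquiv.symm_symm, hR3]⟩

/-- **The flat stratum in any horizontal direction.** For a profile of the route's Type-I class that is poloidal along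
`e₃` (`⟪curl v(s), e₃⟫ ≡ 0`): if for some horizontal `a ≠ 0` (`⟪a, e₃⟫ = 0`) the component `v·e₃` is independent of
the direction `a` on every slice (`⟪Dv(s)(y) a, e₃⟫ = 0`), then the apex `(0,0)` is not backward-singular. (For
`a = e₀` this is the birth-skeleton stub `stub_flatStratum`; the general case is conjugate to it by a reflection
fixing `e₃`.) -/
theorem flatStratum_of_horizontal {C : ℝ} {v : ℝ → EuclideanSpace ℝ (Fin 3) → EuclideanSpace ℝ (Fin 3)}
    (hrate : HasTypeITimeDecay C v) (hcont : ContinuousOn (uncurry v) (Iio (0 : ℝ) ×ˢ univ))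
    (hmild : ∀ s t : ℝ, s < t → t < 0 → ∀ x,
      v t x = UnboundedOperators.heatExtension (v s) (t - s) x - oseenDuhamel 1 s v v t x)
    (hdiv : ∀ t < 0, VectorCalculus.IsDivFree (v t))
    (hpol : ∀ s < 0, ∀ y, ⟪curl (v s) y, EuclideanSpace.single 2 1⟫_ℝ = 0)
    {a : EuclideanSpace ℝ (Fin 3)} (ha : a ≠ 0) (ha3 : ⟪a, EuclideanSpace.single 2 1⟫_ℝ = 0)
    (hflat : ∀ s < 0, ∀ y, ⟪fderiv ℝ (v s) y a, EuclideanSpace.single 2 1⟫_ℝ = 0) :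
    ¬ IsBackwardSingularPoint v 0 := by
  intro hsing
  obtain ⟨L, hL0, hL2⟩ := exists_linearIsometryEquiv_symm_single_zero_fix_single_two ha ha3
  obtain ⟨hrate', hcont', hmild', hdiv'⟩ := class_conj_linearIsometryEquiv L hrate hcont hmild hdiv
  -- the conjugated profile is poloidal along `e₃ = L⁻¹ e₃`
  have hpol' : ∀ s < 0, ∀ y, ⟪curl ((fun t x => L (v t (L.symm x))) s) y, EuclideanSpace.single 2 1⟫_ℝ = 0 := by
    intro s hs y
    refine (inner_curl_conj_linearIsometryEquiv_eq_zero_iff L (v s) y (EuclideanSpace.single 2 1)).2 ?_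
    rw [hL2]
    exact hpol s hs (L.symm y)
  -- and flat along `e₀ = L (a/‖a‖)`
  have hflat' : ∀ s < 0, ∀ y,
      fderiv ℝ ((fun t x => L (v t (L.symm x))) s) y (EuclideanSpace.single 0 1) 2 = 0 := by
    intro s hs y
    have hD : fderiv ℝ (fun x => L (v s (L.symm x))) y (EuclideanSpace.single 0 1) =
        L (fderiv ℝ (v s) (L.symm y) (L.symm (EuclideanSpace.single 0 1))) := by
      rw [fderiv_conj_linearIsometryEquiv]
      rfl
    have h2 : fderiv ℝ (fun x => L (v s (L.symm x))) y (EuclideanSpace.single 0 1) 2 =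
        ⟪fderiv ℝ (fun x => L (v s (L.symm x))) y (EuclideanSpace.single 0 1), EuclideanSpace.single 2 1⟫_ℝ := by
      simp [EuclideanSpace.inner_single_right]
    show fderiv ℝ (fun x => L (v s (L.symm x))) y (EuclideanSpace.single 0 1) 2 = 0
    rw [h2, hD, LinearIsometryEquiv.inner_map_eq_flip, hL2, hL0, map_smul, real_inner_smul_left,
      hflat s hs (L.symm y), mul_zero]
  exact stub_flatStratum C (fun t x => L (v t (L.symm x))) hrate' hcont' hmild' hdiv' hpol' hflat'
    (isBackwardSingularPoint_zero_conj L hsing)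

end Summit.NavierStokesRegularity.NavierStokesRegularity.Theorems.PoloidalWindowDoorPoloidalWindowRigidityFlatHorizontal

end
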